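import Literature.MathematicalPhysics.QuantumManyBody.GroundStateFeynmanKacWitness
import Literature.MathematicalPhysics.QuantumManyBody.GroundStateFeynmanKacCutLine
import HarnessLib

/-!
# Ground state of the Feynman–Kac semigroup, XIII: Bose symmetry of the ground-state function

Part of the proof of `GroundStateFeynmanKac` (Chung–Zhao (1995), Thm 3.17 with §8.3; Reed–Simon
IV §XIII.12: the nondegenerate absolute ground state is permutation symmetric).  For the continuous
representative `φ₀ = μ₀⁻¹ T_1 e⁺` of `GroundStateFeynmanKacWitness.lean`:

* `measurePreserving_relabel(_restrict)` — relabelling the particles `X ↦ X ∘ σ` preserves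
  Lebesgue measure on `(ℝ³)^N` and on the box `Λ_L^N`;
* `fkReal_comp_perm` — **covariance** `(e^{-tH_N} f)(X ∘ σ) = (e^{-tH_N}(f ∘ (· ∘ σ)))(X)` for
  `f ≥ 0` (`fkSemigroup_comp_perm`: the Wiener law, the box and the interaction are invariant);
* `gs_comp_perm` — **`φ₀ (X ∘ σ) = φ₀ X` for every permutation `σ` and every `X`**: the relabelled
  class `e ∘ (· ∘ σ)` is again a nonnegative unit eigenvector of `T_1` for `μ₀`, hence equals `e`
  by simplicity (`fkL2_perronFrobenius`), and the everywhere-defined `φ₀` inherits the symmetry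
  through the covariant path-integral formula.

## References

* K. L. Chung, Z. Zhao, *From Brownian Motion to Schrödinger's Equation* (1995), Thm 3.17.
  [cite: ChungZhao1995, Thm 3.17]
* M. Reed, B. Simon, *Methods of Modern Mathematical Physics IV* (1978), §XIII.12. [folklore]
-/

noncomputable section

namespace Literature.MathematicalPhysics.QuantumManyBody.BoseGas

open MeasureTheory ProbabilityTheory Filter Set
open scoped ENNReal NNReal Topology InnerProductSpace

variable {N : ℕ}

/-! ### Relabelling the particles -/

/-- Relabelling is measurable. [folklore] -/
theorem measurable_relabel (σ : Equiv.Perm (Fin N)) :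
    Measurable fun X : Config N => X ∘ σ :=
  measurable_pi_lambda _ fun i => measurable_pi_apply (σ i)

/-- **Relabelling preserves Lebesgue measure on `(ℝ³)^N`.** [folklore] -/
theorem measurePreserving_relabel (σ : Equiv.Perm (Fin N)) :
    MeasurePreserving (fun X : Config N => X ∘ σ) volume volume := by
  have h := (volume_measurePreserving_piCongrLeft (fun _ : Fin N => Space) σ).symm _
  have e : ⇑(MeasurableEquiv.piCongrLeft (fun _ : Fin N => Space) σ).symm =
      fun (X : Config N) => X ∘ σ := by
    funext X
    ext i : 1
    simp [MeasurableEquiv.piCongrLeft, Equiv.piCongrLeft_symm_apply]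
  rw [e] at h
  exact h

/-- The box is invariant under relabelling. [folklore] -/
theorem relabel_preimage_boxN (σ : Equiv.Perm (Fin N)) (L : ℝ) :
    (fun X : Config N => X ∘ σ) ⁻¹' boxN N L = boxN N L := by
  ext X
  exact ⟨fun h i => by simpa using h (σ.symm i), fun h i => h (σ i)⟩

/-- **Relabelling preserves Lebesgue measure on the box.** [folklore] -/
theorem measurePreserving_relabel_restrict (σ : Equiv.Perm (Fin N)) (L : ℝ) :
    MeasurePreserving (fun X : Config N => X ∘ σ) (volume.restrict (boxN N L))
      (volume.restrict (boxN N L)) := by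
  have h := (measurePreserving_relabel σ).restrict_preimage (measurableSet_boxN N L)
  rwa [relabel_preimage_boxN] at h

/-- **Covariance of the real Feynman–Kac functional** for `f ≥ 0`:
`(e^{-tH_N} f)(X ∘ σ) = (e^{-tH_N}(f ∘ (· ∘ σ)))(X)`. [folklore] -/
theorem fkReal_comp_perm (σ : Equiv.Perm (Fin N)) {v : ℝ → ℝ≥0∞} (hv : Measurable v) (L t : ℝ)
    {f : Config N → ℝ} (hf : Measurable f) (hf0 : ∀ Y, 0 ≤ f Y) (X : Config N) :
    fkReal v L t f (X ∘ σ) = fkReal v L t (fun Y => f (Y ∘ σ)) X := by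
  rw [fkReal_eq_toReal_fkSemigroup hv L t hf hf0,
    fkReal_eq_toReal_fkSemigroup hv L t (f := fun Y => f (Y ∘ σ)) (hf.comp (measurable_relabel σ))
      (fun Y => hf0 _), fkSemigroup_comp_perm σ hv L t hf.ennreal_ofReal X]

/-! ### Bose symmetry -/

section Symm

variable {v : ℝ → ℝ≥0∞} {C : ℝ≥0} {L : ℝ} {e : Lp ℝ 2 (volume.restrict (boxN N L))}
  {φ : Config N → ℝ}

/-- **The relabelled positive part is again an eigenfunction, a.e.**:
`e⁺ ∘ (· ∘ σ) = e⁺` a.e. on the box, by simplicity of `μ₀`. [cite: ChungZhao1995, Thm 3.17] -/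
theorem posRep_comp_perm_ae_eq (hv : Measurable v) (hT1 : fkL2 (N := N) v L 1 ≠ 0)
    (he1 : ‖e‖ = 1) (he0 : 0 ≤ e) (hTe : fkL2 v L 1 e = ‖fkL2 (N := N) v L 1‖ • e)
    (hsimple : ∀ f, fkL2 v L 1 f = ‖fkL2 (N := N) v L 1‖ • f → ∃ c : ℝ, f = c • e)
    (σ : Equiv.Perm (Fin N)) :
    ((fun Y => max ((e : Config N → ℝ) Y) 0) ∘ fun Y : Config N => Y ∘ σ)
      =ᵐ[volume.restrict (boxN N L)] fun Y => max ((e : Config N → ℝ) Y) 0 := by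
  have hμ₀ : 0 < ‖fkL2 (N := N) v L 1‖ := norm_pos_iff.2 hT1
  obtain ⟨ep, hepdef⟩ : ∃ ep : Config N → ℝ, ep = fun Y => max ((e : Config N → ℝ) Y) 0 :=
    ⟨_, rfl⟩
  obtain ⟨ρ, hρdef⟩ : ∃ ρ : Config N → Config N, ρ = fun Y => Y ∘ σ := ⟨_, rfl⟩
  rw [← hepdef, ← hρdef]
  have hp : MeasurePreserving ρ (volume.restrict (boxN N L)) (volume.restrict (boxN N L)) := by
    rw [hρdef]; exact measurePreserving_relabel_restrict (N := N) σ L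
  have hmeas : Measurable ep := by rw [hepdef]; exact measurable_posRep e
  have hep0 : ∀ Y, 0 ≤ ep Y := fun Y => by rw [hepdef]; exact le_max_right _ _
  have hep_ae : ep =ᵐ[volume.restrict (boxN N L)] (e : Config N → ℝ) := by
    rw [hepdef]; exact posRep_ae_eq he0
  have hTep : fkReal v L 1 ep =ᵐ[volume.restrict (boxN N L)]
      fun Y => ‖fkL2 (N := N) v L 1‖ * (e : Config N → ℝ) Y := by
    rw [hepdef]; exact fkReal_posRep_ae_eq hv he0 hTe
  have hcov : ∀ Y, fkReal v L 1 (ep ∘ ρ) Y = fkReal v L 1 ep (ρ Y) := fun Y => by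
    rw [hρdef]
    exact (fkReal_comp_perm σ hv L 1 hmeas hep0 Y).symm
  have hmem : MemLp ep 2 (volume.restrict (boxN N L)) := (Lp.memLp e).ae_eq hep_ae.symm
  have hmemσ : MemLp (ep ∘ ρ) 2 (volume.restrict (boxN N L)) := hmem.comp_measurePreserving hp
  obtain ⟨eσ, heσdef⟩ : ∃ x : Lp ℝ 2 (volume.restrict (boxN N L)), x = hmemσ.toLp _ := ⟨_, rfl⟩
  have heσ : (eσ : Config N → ℝ) =ᵐ[volume.restrict (boxN N L)] (ep ∘ ρ) := by
    rw [heσdef]; exact hmemσ.coeFn_toLp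
  -- `T_1 eσ = μ₀ eσ`
  have hstep : (fkReal v L 1 ep ∘ ρ) =ᵐ[volume.restrict (boxN N L)]
      ((fun Y => ‖fkL2 (N := N) v L 1‖ * (e : Config N → ℝ) Y) ∘ ρ) :=
    hp.quasiMeasurePreserving.ae_eq_comp hTep
  have hep_aeσ : (ep ∘ ρ) =ᵐ[volume.restrict (boxN N L)] ((e : Config N → ℝ) ∘ ρ) :=
    hp.quasiMeasurePreserving.ae_eq_comp hep_ae
  have hTσ : fkL2 v L 1 eσ = ‖fkL2 (N := N) v L 1‖ • eσ := by
    refine Lp.ext ?_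
    filter_upwards [fkL2_coeFn hv L one_pos eσ, Lp.coeFn_smul ‖fkL2 (N := N) v L 1‖ eσ, hstep,
      heσ, hep_aeσ] with Y h1 h2 h3 h4 h5
    rw [h1, fkReal_congr_ae_restrict v L one_pos heσ Y, h2, Pi.smul_apply, smul_eq_mul, h4, h5,
      hcov Y]
    exact h3
  obtain ⟨c, hc⟩ := hsimple eσ hTσ
  -- `‖eσ‖ = 1`, hence `|c| = 1`
  have hnorm : ‖eσ‖ = 1 := by
    rw [heσdef, Lp.norm_toLp, eLpNorm_comp_measurePreserving hmem.aestronglyMeasurable hp,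
      eLpNorm_congr_ae hep_ae, ← Lp.norm_def, he1]
  have hcabs : |c| = 1 := by
    have := congrArg norm hc
    rw [hnorm, norm_smul, he1, mul_one, Real.norm_eq_abs] at this
    exact this.symm
  have hcoe : (eσ : Config N → ℝ) =ᵐ[volume.restrict (boxN N L)]
      fun Y => c * (e : Config N → ℝ) Y := by
    have h1 : (eσ : Config N → ℝ) =ᵐ[volume.restrict (boxN N L)]
        ((c • e : Lp ℝ 2 (volume.restrict (boxN N L))) : Config N → ℝ) := by
      rw [← hc]
    filter_upwards [h1, Lp.coeFn_smul c e] with Y hY1 hY2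
    rw [hY1, hY2, Pi.smul_apply, smul_eq_mul]
  -- `c = 1`: both classes are nonnegative and nonzero
  have hc1 : c = 1 := by
    rcases (abs_eq zero_le_one).1 hcabs with h | h
    · exact h
    · exfalso
      have hzero : e = 0 := by
        rw [Lp.eq_zero_iff_ae_eq_zero]
        filter_upwards [heσ, (Lp.coeFn_nonneg e).2 he0, hcoe] with Y h1 h2 h3
        have h4 : 0 ≤ (eσ : Config N → ℝ) Y := by rw [h1]; exact hep0 _
        rw [h3, h] at h4
        have h2' : 0 ≤ (e : Config N → ℝ) Y := by simpa using h2
        rw [Pi.zero_apply]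
        linarith
      rw [hzero, norm_zero] at he1
      exact zero_ne_one he1
  rw [hc1] at hcoe
  filter_upwards [heσ, hcoe, hep_ae] with Y h1 h2 h3
  rw [← h1, h2, one_mul, ← h3]

/-- **Bose symmetry of the ground-state function**: `φ₀ (X ∘ σ) = φ₀ X` for every permutation `σ`
of the particles and EVERY `X` (`IsGroundStateFK.symm`). [cite: ChungZhao1995, Thm 3.17] -/
theorem gs_comp_perm (hv : Measurable v) (hT1 : fkL2 (N := N) v L 1 ≠ 0)
    (he1 : ‖e‖ = 1) (he0 : 0 ≤ e) (hTe : fkL2 v L 1 e = ‖fkL2 (N := N) v L 1‖ • e)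
    (hsimple : ∀ f, fkL2 v L 1 f = ‖fkL2 (N := N) v L 1‖ • f → ∃ c : ℝ, f = c • e)
    (hφ : φ = fun X => ‖fkL2 (N := N) v L 1‖⁻¹ *
      fkReal v L 1 (fun Y => max ((e : Config N → ℝ) Y) 0) X)
    (σ : Equiv.Perm (Fin N)) (X : Config N) : φ (X ∘ σ) = φ X := by
  rw [hφ]
  simp only
  rw [fkReal_comp_perm σ hv L 1 (measurable_posRep e) (fun Y => le_max_right _ _) X]
  exact congrArg _ (fkReal_congr_ae_restrict v L one_pos
    (posRep_comp_perm_ae_eq hv hT1 he1 he0 hTe hsimple σ) X)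

end Symm

end Literature.MathematicalPhysics.QuantumManyBody.BoseGas
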